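import Literature.MathematicalPhysics.QuantumFieldTheory.Balaban1983to89.B9Eq3105FamThreeAtMember
import Literature.MathematicalPhysics.QuantumFieldTheory.Balaban1983to89.B9Eq3105FamTwoAtMember
import Literature.MathematicalPhysics.QuantumFieldTheory.Balaban1983to89.B9CubeDataHermitianPart
import Literature.MathematicalPhysics.QuantumFieldTheory.Balaban1983to89.B9Cor36GCubeFamFourAtLocCfg
import Literature.MathematicalPhysics.QuantumFieldTheory.Balaban1983to89.B9Cor36GCubeLocAtMemberClosed
import Literature.MathematicalPhysics.QuantumFieldTheory.Balaban1983to89.B9Thm32CinvAtMemberOfCubeDataThmD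
import Literature.MathematicalPhysics.QuantumFieldTheory.Balaban1983to89.B9Thm311PosAtRecordV4
import Literature.MathematicalPhysics.QuantumFieldTheory.Balaban1983to89.B9Cor36GCubeCutoffsB
import Literature.MathematicalPhysics.QuantumFieldTheory.Balaban1983to89.B9Eq3105ZetaY

/-!
# `Balaban1983to89.B9Eq3105RestAtMember` — THE `hrest` SIDE OF THE BOND-SECTOR MEMBER ASSEMBLER: at the unitary matrix fibre, from the TWELVE per-cube
# (3.35) clauses of the target signature (`B8Thm2TorusCoverOfDeltaAAssembler.hThm2Cover_of_prop6_deltaAAssembler`), every LETTER INPUT of M5.7's endpoint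
# `B9Thm310DeltaAIsUnitOfExpansion.eBlock_kernelFamilyBInv_GAY_of_localInverseCubes''` except the transposed families and the located smallness: the laws
# `hP1`, `hdef`, `hdefT`, the cube letters' blocks `hE` at ONE rate `δ₀`, the bi-contractivity inputs `hU`, `hT`, `IsUnit Δ′_a(U₁)`, and the remainder's
# majorant `hrest = family 2 + family 3 + family 4 + defect family ≺ K₀·M_h⁻¹·e^{−δ₀d}` with `δ₀, K₀` MEMBER-INDEPENDENT — for the located letters of
# record at the HERMITIAN REPRESENTATIVE `Aʰ_□ = ½(A_□ + A_□⋆)` of the cube data (file ASM1-R; seat p33 gen 105)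

T. Bałaban, *Propagators for lattice gauge theories in a background field*, Commun. Math. Phys. **99** (1985) 389–434 [`Balaban1985BackgroundPropagators`,
"B9"]: (3.105)–(3.106) p. 414, p. 415 l. 1–37 (the four families), Thm 3.10 p. 416, Cor. 3.6 p. 408, (3.35)–(3.37) p. 396, Thm 3.11 p. 416; [4] =
[`Balaban1984PropagatorsII`] Lemma 2.1 (2.60)–(2.61) p. 234.

statement-level skeleton of published theorems with citation tags; proofs where landed; nothing here is a claim about the Yang–Mills mass gap

WHY THIS FILE (cell `lit-balaban`; scope memo `run/shared/lean/pub/lit-balaban/lit-balaban-p33/g105/ASSEMBLER-SCOPE.md`).  The member assembler's endpoint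
(M5.7, p. 414 «For M sufficiently large this implies G = G₀(I − R)⁻¹») displays, besides two located smallness conditions and the (2.61)∕(2.63) inputs, a list
of LETTER inputs at an arbitrary cube-letter family `O_□`: the (3.101) law `hP1`, the defect laws `hdef`∕`hdefT`, the blocks `hE` of the `O_□`, the
bi-contractivity of `U₁` and of the bond transporters, and the majorants `hrest` ∕ `hV′` of families 2–4 (+ defect) of the remainder `R` and of their
transposes.  Every one of them is now an ∃-threshold package over the twelve cube-data clauses — p38 `eBlock_locLetterBY''` (the `O_□`), p33
`localInverse_defect_laws_chiY_parBY` (the laws), P2 `famTwo_at_member`, P3 `famThree_at_member`, `sum_conj_famFour_at_locCfg'`, `sum_conj_locDefect_at_locCfg'`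
(the families) — modulo member-level letters that the unitary matrix fibre supplies: FILE 9 `eBlock_GpY_of_cubeData_unitary` (`G′`), FILE 10-D
`cinv_at_member_of_cubeData_thmD` (`(Q′G′²Q′*)⁻¹`), Thm 3.11's `isUnit_XY_parSymY` ∕ `isUnit_deltaPrimeAY_parSymY`, def-Y's `parSymY_mem` ∕ `parBY_mem`
(unitary transporters), and file H `hermitianPart_cubeData` (the located letters' thirteenth clause, at `Aʰ`).  THIS FILE performs that knit ONCE for the
`hrest` side: one common rate `δ₀ = min(ρ₂, ρ₃, δ₄, δ_E, δ_O)`, one constant `K₀·M_h⁻¹` (`e^{−κM_h} ≤ (κM_h)⁻¹`, `(L·M_h)⁻¹ ≤ M_h⁻¹`), thresholds `max`,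
(3.37) size `min`.  The `hV′` side (transposed families; p38's P3T) is the twin file ASM1-V; the located smallness is ASM2.

WHAT THIS FILE PROVES (theorems only; 0 `def`, 0 `def … : Prop`, 0 sorry; standard axioms).
* §0 (private) `exp_neg_mul_le_inv` (`e^{−κM} ≤ κ⁻¹M⁻¹`), `eBlock_rate_mono` (the (3.42) block is monotone in the constant, anti-monotone in the rate).
* §1 ★★★ `rest_at_member` — `∃ δ₀ K₀ B₀ M₀ T₀ N₀ a₁`, for every member above the thresholds with `c_f = L^k`, every section `ιB`, every unitary-valued `U`,
  bi-contractive gauges `u_□` and data `(A_□, Q_□, C_□, ξ_□, Λ_□)` obeying the twelve clauses, every background family through `U`: the endpoint's `hP1`,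
  `hdef`, `hdefT`, `hE` (rate `δ₀`, constant `B₀`), `hU`, `hT`, `IsUnit Δ′_a(U₁)` and `hrest ≺ K₀·M_h⁻¹·e^{−δ₀d}` at the letters
  `O_□ = locLetterBY … (u_□) (χ_□) (Ṽ_□)`, `P_{□,loc} = locProjBY`, `P_{□,1} = locP1BY`, `E_□ = locDefectBY`, `E_□ᵗ = locDefectTBY`, `ζ_□ = zetaY`, with
  `Ṽ_□ = e^{iηχ̃_□Aʰ_□}`, `Aʰ_□ = ½(A_□ + A_□⋆)` written out.

HONEST SCOPE.  Pure bookkeeping over landed theorems (no estimate added or removed); the defect family is an (R)-design term, NOT in print (`= 0` for print's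
exact local inverses).  NOT here: `hV′` (ASM1-V), the located smallness and the conclusion (1ₛ) ∧ (Eₛ) (ASM2).  Count-neutral; no summit ∕ node statement
proved; nothing continuum ∕ OS ∕ mass gap ∕ Clay; YM mass gap NOT proved (Track A conditional rung).  `--supports stmt-QuantumFields-19200`.
RELATED, NOT DUPLICATED (searched 2026-08-29: `lean search 'rest_at_member|RestAtMember' --decl` ∅): all suppliers USED BY NAME (imports).
-/

noncomputable section

open scoped BigOperators Matrix Matrix.Norms.L2Operator

namespace Literature.MathematicalPhysics.QuantumFieldTheory.Balaban1983to89.B9Eq3105RestAtMember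

open NormedSpace Complex
open B6RandomWalk (HasMajorant hasMajorant_mono hasMajorant_add)
open B9Thm34Ext (toB6)
open B9FromB6 (EBlock)
open B9Eq352DivFormLetters (conj)
open B6KLevelCensusIndexV1 (KIdx kGeo)
open B6Cover236MultiLevelBlocks (cubes)
open B6GlobalChartV1 (PV boxEquiv blkV1)
open B6Ineq2142KLevelV1 (β)
open B9GeoNormsKLevelV1 (geo9K)
open B9BackgroundsKLevelV1 (shiftsV1)
open B9Eq39Adjoint (fluct covD)
open B9Eq360DeltaPrimeAY (AfldY)
open B9CubeGeometryInputs (RM1)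
open B9CubeLettersInvReadings (kernelFamilySInv kernelFamilyBInv)
open B9Thm37CubeCoverCommutators (cutMulY hTY)
open B4PartitionUnity22 (thetaProf D1)
open B9Cor36CubeCutoffs (SC NearC chiY locCfgY one_le_SC)
open B9Eq3104CutoffCommutators (hBdY DPDsY deltaLocY)
open B9Eq3105ZetaY (zetaY abs_zetaY_le_one)
open B9Cor36GCubeLocLetter (locLetterBY locProjBY locP1BY locDefectBY locDefectTBY)
open B9Cor36GCubeCutoffsB (localInverse_defect_laws_chiY_parBY)
open B9Cor36GCubeFamFourAtLocCfg (sum_conj_famFour_at_locCfg')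
open B9Cor36GCubeLocDefectAtLocCfg (sum_conj_locDefect_at_locCfg')
open B9Cor36GCubeLocAtMemberClosed (eBlock_locLetterBY'')
open B9Thm32CinvAtMemberOfCubeDataThmD (cinv_at_member_of_cubeData_thmD)
open B9Eq3105FamTwoAtMember (famTwo_at_member)
open B9Eq3105FamThreeAtMember (famThree_at_member)
open B9CubeDataHermitianPart (hermitianPart_cubeData mem_unitaryUnits_of_bicontractive)
open B7Prop2Explicit (unitaryUnits mem_unitaryUnits unitaryUnits_le_U1)
open B7Prop1Explicit (mem_U1)
open Node00 (SiteY BlkY IBondY FBondY CfgY GaugeY SiteOpY BondOpY SiteParY BondParY toKT UboxY GpY deltaPrimeAY gaugeY gaugeY_apply parSymY parBY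
  parSymY_mem parBY_mem etaS XY XinvY qT)

variable {d ℓ : ℕ} {hd : 1 ≤ d + 1} {hL : Odd (ℓ + 1) ∧ 1 < ℓ + 1} {b₀ b₁ : ℝ}
variable {ι : Type} [Fintype ι]

/-! ## §0 Two bookkeeping lemmas -/

/-- `e^{−κM} ≤ κ⁻¹M⁻¹` for `κ, M > 0` (`x + 1 ≤ eˣ`). [folklore] -/
private theorem exp_neg_mul_le_inv {κ M : ℝ} (hκ : 0 < κ) (hM : 0 < M) : Real.exp (-(κ * M)) ≤ κ⁻¹ * M⁻¹ := by
  have h1 : κ * M + 1 ≤ Real.exp (κ * M) := Real.add_one_le_exp _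
  have h2 : 0 < κ * M := mul_pos hκ hM
  rw [Real.exp_neg, ← mul_inv]
  exact inv_anti₀ h2 (by linarith)

/-- the (3.42) block is monotone in its constant and anti-monotone in its rate (every factor is nonnegative, distances are `≥ 0`).
[cite: Balaban1985BackgroundPropagators, (3.42) p.397, bookkeeping] -/
theorem eBlock_rate_mono (i : KIdx d ℓ hd hL b₀ b₁) {B : B9.Backgrounds} (K : B9.KernelFamily (geo9K i) B) {B₀ B₀' δ δ' : ℝ} {U : B.Cfg}
    (hle : B₀ ≤ B₀') (hδ : δ' ≤ δ) (h0' : 0 ≤ B₀') (h : EBlock K B₀ δ U) : EBlock K B₀' δ' U := by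
  intro n lam y y' hs
  refine (h n lam y y' hs).trans ?_
  have h1 : 0 ≤ B9.pref4 ((geo9K i).len y) n := B9FromB6.pref4_nonneg (B6KLevelCensusIndexV1.len_pos i y).le n
  have h2 := B9GeoNormsKLevelV1.geo9K_supNorm_nonneg i lam
  have hdist := B9GeoLemma21KLevelV1.geo9K_dist_nonneg' i y y'
  have h3 : Real.exp (-(δ * (geo9K i).dist y y')) ≤ Real.exp (-(δ' * (geo9K i).dist y y')) :=
    Real.exp_le_exp.mpr (by nlinarith [mul_le_mul_of_nonneg_right hδ hdist])
  calc B₀ * B9.pref4 ((geo9K i).len y) n * Real.exp (-(δ * (geo9K i).dist y y')) * (geo9K i).supNorm lam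
      ≤ B₀' * B9.pref4 ((geo9K i).len y) n * Real.exp (-(δ * (geo9K i).dist y y')) * (geo9K i).supNorm lam :=
        mul_le_mul_of_nonneg_right (mul_le_mul_of_nonneg_right (mul_le_mul_of_nonneg_right hle h1) (Real.exp_pos _).le) h2
    _ ≤ B₀' * B9.pref4 ((geo9K i).len y) n * Real.exp (-(δ' * (geo9K i).dist y y')) * (geo9K i).supNorm lam :=
        mul_le_mul_of_nonneg_right (mul_le_mul_of_nonneg_left h3 (mul_nonneg h0' h1)) h2

/-- the law's collar radius `3S + 2` lies inside the datum's `35S∕8 + 1` for `S ≥ 1` (integer arithmetic). [cite: Balaban1985BackgroundPropagators, Cor. 3.6 p.408, bookkeeping] -/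
private theorem radius_le (s : ℤ) (hs : 1 ≤ s) : 3 * s + 2 ≤ 35 * s / 8 + 1 := by omega

/-! ## §1 ★★★ The `hrest` side of the member assembler -/

set_option maxHeartbeats 4000000 in
/-- ★★★ **THE `hrest` SIDE OF THE BOND-SECTOR MEMBER ASSEMBLER** (p. 414 (3.105) families 2–4 «Σ_□(1 − ζ_□̃)DPD*h_□G_□h_□», «Σ_□ζ_□̃(DPD* − DP_□D*)h_□G_□h_□»,
«Σ_□ζ_□̃P_{□,1}(∂h_□)G_□h_□» + the (R)-design defect family, p. 414 «R satisfies the bound (3.85) with O(M⁻¹)»): at the unitary matrix fibre, from the twelve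
(3.35) cube-data clauses, the member-level LETTER inputs of M5.7's endpoint at the located letters of the hermitian representative `Aʰ`, with
`hrest ≺ K₀·M_h⁻¹·e^{−δ₀d}`, `δ₀, K₀, B₀` member-independent.  DEFECT LABEL: the fourth family is an (R)-design term, NOT in print.
[cite: Balaban1985BackgroundPropagators, (3.105)–(3.106) p.414, p.415 l.1–37, Thm 3.10 p.416, Cor. 3.6 p.408, (3.35)–(3.37) p.396, Thm 3.11 p.416; Balaban1984PropagatorsII, Lemma 2.1 (2.60)–(2.61) p.234] -/
theorem rest_at_member {N : ℕ} [NeZero N] [DecidableEq ι]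
    [∀ i' : KIdx d ℓ hd hL b₀ b₁, Fintype (geo9K i').Site] [∀ i' : KIdx d ℓ hd hL b₀ b₁, DecidableEq (geo9K i').Site]
    (Rr : KIdx d ℓ hd hL b₀ b₁ → ℝ) (Hp : KIdx d ℓ hd hL b₀ b₁ → Prop) (b : Module.Basis ι ℝ (Matrix (Fin N) (Fin N) ℂ)) (hℓ : 1 ≤ ℓ)
    (hb₀ : 0 < b₀) (hb₁ : b₀ ≤ b₁) {M₂ : ℝ} (hM₂ : 0 ≤ M₂) (hrepr : ∀ (v : (Matrix (Fin N) (Fin N) ℂ)) (j : ι), |b.repr v j| ≤ M₂ * ‖v‖) :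
    ∃ δ₀ K₀ B₀ M₀ T₀ : ℝ, ∃ N₀ : ℕ, 0 < δ₀ ∧ 0 ≤ K₀ ∧ 0 ≤ B₀ ∧ ∃ a₁ : ℝ, 0 < a₁ ∧
    ∀ (i : KIdx d ℓ hd hL b₀ b₁),
      M₀ ≤ ((ℓ : ℝ) + 1) * (toKT i).Mh → N₀ + 1 ≤ (toKT i).R * ((ℓ + 1) * (toKT i).Mh) → T₀ ≤ RM1 i → i.cf = (((ℓ + 1 : ℕ) : ℝ)) ^ i.k →
    ∀ (ιB : BlkY i → IBondY i), (∀ s, β i.hN i.D i.hk (ιB s) = s) →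
    ∀ (U : CfgY (Matrix (Fin N) (Fin N) ℂ) i), (∀ μ x, U μ x ∈ unitaryUnits (Matrix (Fin N) (Fin N) ℂ)) →
    ∀ (g : ↥(cubes (toKT i).D.toDomains) → GaugeY (Matrix (Fin N) (Fin N) ℂ) i),
      (∀ c x, ‖(g c x : (Matrix (Fin N) (Fin N) ℂ))‖ ≤ 1 ∧ ‖(((g c x)⁻¹ : (Matrix (Fin N) (Fin N) ℂ)ˣ) : (Matrix (Fin N) (Fin N) ℂ))‖ ≤ 1) →
    ∀ (A : ↥(cubes (toKT i).D.toDomains) → AfldY (Matrix (Fin N) (Fin N) ℂ) i)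
      (Q : ↥(cubes (toKT i).D.toDomains) → Set (Site (PV d ℓ i.m i.K hd hL) 0)) (C ξ Λ : ↥(cubes (toKT i).D.toDomains) → ℝ),
      (∀ c, 0 ≤ C c) → (∀ c, 0 < ξ c) → (∀ c, 1 ≤ Λ c) → (∀ c, ξ c ≤ 5 * (SC i c : ℝ) * (kGeo i).eta) →
      (∀ c, LatticeNorms.scaleLen ((ℓ : ℝ) + 1) (kGeo i).eta (c.1.1 + 1) ≤ Λ c * ξ c) →
      (∀ c, ∀ x : Site (PV d ℓ i.m i.K hd hL) 0, NearC i c (35 * SC i c / 8 + 1) (boxEquiv i.hN x).1 → x ∈ Q c) →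
      (∀ c, ∀ (κ : Fin (d + 1)) (x : Site (PV d ℓ i.m i.K hd hL) 0), x ∈ Q c → x.shift κ ∈ Q c →
        gaugeY i (g c) U κ x = fluct (kGeo i).eta (A c) κ x) →
      (∀ c, ∀ κ, ∀ x ∈ Q c, ‖A c κ x‖ ≤ C c * (ξ c)⁻¹) →
      (∀ c, ∀ μ ν, ∀ x ∈ Q c,
        ‖(((kGeo i).eta : ℂ)⁻¹) • covD (shiftsV1 (PV d ℓ i.m i.K hd hL)) (fun _ _ => (1 : (Matrix (Fin N) (Fin N) ℂ)ˣ)) μ (A c ν) x‖ ≤ C c * (ξ c ^ 2)⁻¹) →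
      (∀ c, max (C c) (C c * (1 + D1 thetaProf)) * Λ c ^ 2 ≤ a₁) → (∀ c, max (C c) (C c * (1 + D1 thetaProf)) * Λ c ^ 2 ≤ 1 / 4) →
    ∀ {B : B9.Backgrounds} (cfg : B.Cfg → CfgY (Matrix (Fin N) (Fin N) ℂ) i) (par : BondParY (Matrix (Fin N) (Fin N) ℂ) i) (U₁ : B.Cfg), cfg U₁ = U →
      (∀ c : ↥(cubes i.D.toDomains), locProjBY i c (parSymY i) (g c) (locCfgY i c (kGeo i).eta (fun κ x => (2 : ℂ)⁻¹ • (A c κ x + star (A c κ x)))) * cutMulY (𝔸 := (Matrix (Fin N) (Fin N) ℂ)) (hBdY i (hTY i c)) = cutMulY (𝔸 := (Matrix (Fin N) (Fin N) ℂ)) (hBdY i (hTY i c)) * locProjBY i c (parSymY i) (g c) (locCfgY i c (kGeo i).eta (fun κ x => (2 : ℂ)⁻¹ • (A c κ x + star (A c κ x)))) + locP1BY i c (parSymY i) (g c) (hTY i c) (locCfgY i c (kGeo i).eta (fun κ x => (2 : ℂ)⁻¹ • (A c κ x + star (A c κ x))))) ∧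
      (∀ c : ↥(cubes i.D.toDomains), cutMulY (𝔸 := (Matrix (Fin N) (Fin N) ℂ)) (hBdY i (hTY i c)) * (deltaLocY i (parBY i) (cfg U₁) - locProjBY i c (parSymY i) (g c) (locCfgY i c (kGeo i).eta (fun κ x => (2 : ℂ)⁻¹ • (A c κ x + star (A c κ x))))) * locLetterBY i c (parSymY i) (parBY i) (g c) (chiY i c) (locCfgY i c (kGeo i).eta (fun κ x => (2 : ℂ)⁻¹ • (A c κ x + star (A c κ x)))) * cutMulY (𝔸 := (Matrix (Fin N) (Fin N) ℂ)) (hBdY i (hTY i c)) =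
        cutMulY (𝔸 := (Matrix (Fin N) (Fin N) ℂ)) (hBdY i (hTY i c)) * cutMulY (𝔸 := (Matrix (Fin N) (Fin N) ℂ)) (hBdY i (hTY i c)) - locDefectBY i c (parSymY i) (parBY i) (g c) (chiY i c) (hTY i c) (locCfgY i c (kGeo i).eta (fun κ x => (2 : ℂ)⁻¹ • (A c κ x + star (A c κ x))))) ∧
      (∀ c : ↥(cubes i.D.toDomains), cutMulY (𝔸 := (Matrix (Fin N) (Fin N) ℂ)) (hBdY i (hTY i c)) * locLetterBY i c (parSymY i) (parBY i) (g c) (chiY i c) (locCfgY i c (kGeo i).eta (fun κ x => (2 : ℂ)⁻¹ • (A c κ x + star (A c κ x)))) * (deltaLocY i (parBY i) (cfg U₁) - locProjBY i c (parSymY i) (g c) (locCfgY i c (kGeo i).eta (fun κ x => (2 : ℂ)⁻¹ • (A c κ x + star (A c κ x))))) * cutMulY (𝔸 := (Matrix (Fin N) (Fin N) ℂ)) (hBdY i (hTY i c)) =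
        cutMulY (𝔸 := (Matrix (Fin N) (Fin N) ℂ)) (hBdY i (hTY i c)) * cutMulY (𝔸 := (Matrix (Fin N) (Fin N) ℂ)) (hBdY i (hTY i c)) - locDefectTBY i c (parSymY i) (parBY i) (g c) (chiY i c) (hTY i c) (locCfgY i c (kGeo i).eta (fun κ x => (2 : ℂ)⁻¹ • (A c κ x + star (A c κ x))))) ∧
      (∀ c : ↥(cubes i.D.toDomains), EBlock (kernelFamilyBInv i B cfg (fun _ => locLetterBY i c (parSymY i) (parBY i) (g c) (chiY i c) (locCfgY i c (kGeo i).eta (fun κ x => (2 : ℂ)⁻¹ • (A c κ x + star (A c κ x))))) par) B₀ δ₀ U₁) ∧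
      (∀ μ x, ‖(cfg U₁ μ x : (Matrix (Fin N) (Fin N) ℂ))‖ ≤ 1 ∧ ‖(((cfg U₁ μ x)⁻¹ : (Matrix (Fin N) (Fin N) ℂ)ˣ) : (Matrix (Fin N) (Fin N) ℂ))‖ ≤ 1) ∧
      (∀ (y : IBondY i) (f : FBondY i), ‖(qT i (parBY i) (cfg U₁) y f : (Matrix (Fin N) (Fin N) ℂ))‖ ≤ 1 ∧ ‖(((qT i (parBY i) (cfg U₁) y f)⁻¹ : (Matrix (Fin N) (Fin N) ℂ)ˣ) : (Matrix (Fin N) (Fin N) ℂ))‖ ≤ 1) ∧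
      IsUnit (deltaPrimeAY i (parSymY i) (cfg U₁)) ∧
      HasMajorant (g := toB6 (geo9K i) (Rr i) (Hp i)) (fun p : FBondY i × ι => ιB (blkV1 i.hN i.D p.1))
        (∑ c : ↥(cubes i.D.toDomains), conj b (((1 - cutMulY (𝔸 := (Matrix (Fin N) (Fin N) ℂ)) (hBdY i (zetaY i c))) * DPDsY i (parSymY i) (GpY i (parSymY i)) (cfg U₁) * (cutMulY (𝔸 := (Matrix (Fin N) (Fin N) ℂ)) (hBdY i (hTY i c)) * locLetterBY i c (parSymY i) (parBY i) (g c) (chiY i c) (locCfgY i c (kGeo i).eta (fun κ x => (2 : ℂ)⁻¹ • (A c κ x + star (A c κ x)))) * cutMulY (𝔸 := (Matrix (Fin N) (Fin N) ℂ)) (hBdY i (hTY i c)))).restrictScalars ℝ)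
          + ∑ c : ↥(cubes i.D.toDomains), conj b ((cutMulY (𝔸 := (Matrix (Fin N) (Fin N) ℂ)) (hBdY i (zetaY i c)) * (DPDsY i (parSymY i) (GpY i (parSymY i)) (cfg U₁) - locProjBY i c (parSymY i) (g c) (locCfgY i c (kGeo i).eta (fun κ x => (2 : ℂ)⁻¹ • (A c κ x + star (A c κ x))))) * (cutMulY (𝔸 := (Matrix (Fin N) (Fin N) ℂ)) (hBdY i (hTY i c)) * locLetterBY i c (parSymY i) (parBY i) (g c) (chiY i c) (locCfgY i c (kGeo i).eta (fun κ x => (2 : ℂ)⁻¹ • (A c κ x + star (A c κ x)))) * cutMulY (𝔸 := (Matrix (Fin N) (Fin N) ℂ)) (hBdY i (hTY i c)))).restrictScalars ℝ)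
          + ∑ c : ↥(cubes i.D.toDomains), conj b ((cutMulY (𝔸 := (Matrix (Fin N) (Fin N) ℂ)) (hBdY i (zetaY i c)) * locP1BY i c (parSymY i) (g c) (hTY i c) (locCfgY i c (kGeo i).eta (fun κ x => (2 : ℂ)⁻¹ • (A c κ x + star (A c κ x)))) * locLetterBY i c (parSymY i) (parBY i) (g c) (chiY i c) (locCfgY i c (kGeo i).eta (fun κ x => (2 : ℂ)⁻¹ • (A c κ x + star (A c κ x)))) * cutMulY (𝔸 := (Matrix (Fin N) (Fin N) ℂ)) (hBdY i (hTY i c))).restrictScalars ℝ)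
          + ∑ c : ↥(cubes i.D.toDomains), conj b ((locDefectBY i c (parSymY i) (parBY i) (g c) (chiY i c) (hTY i c) (locCfgY i c (kGeo i).eta (fun κ x => (2 : ℂ)⁻¹ • (A c κ x + star (A c κ x))))).restrictScalars ℝ))
        (fun a a' => K₀ * (((toKT i).Mh : ℝ))⁻¹ * Real.exp (-(δ₀ * (geo9K i).dist a a'))) := by
  classical
  letI : CStarAlgebra (Matrix (Fin N) (Fin N) ℂ) := {}
  have hL1 : (1 : ℝ) ≤ (ℓ : ℝ) + 1 := by linarith [(Nat.cast_nonneg ℓ : (0 : ℝ) ≤ ℓ)]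
  have hL0 : (0 : ℝ) < (ℓ : ℝ) + 1 := by positivity
  -- ═══ the member-independent packages ═══
  obtain ⟨δG, KG, M₀G, T₀G, N₀G, hδG, hKG, a₁G, ha₁G, HG⟩ :=
    B9Cor36GpCoverBindersUnitary.eBlock_GpY_of_cubeData_unitary b (le_refl (unitaryUnits (Matrix (Fin N) (Fin N) ℂ))) Rr Hp hℓ hM₂ hrepr
  obtain ⟨δX, KX, M₀X, T₀X, N₀X, hδX, hKX, a₁X, ha₁X, HX⟩ :=
    cinv_at_member_of_cubeData_thmD b (le_refl (unitaryUnits (Matrix (Fin N) (Fin N) ℂ))) Rr Hp hℓ hM₂ hrepr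
  obtain ⟨δO, BO, M₀O, T₀O, N₀O, hδO, hBO, a₁O, ha₁O, HO⟩ := eBlock_locLetterBY'' b hℓ hb₀ hb₁ M₂ hM₂ hrepr
  obtain ⟨ρ₂, κ₂, Θ₂, M₀₂, hρ₂, hκ₂, hΘ₂, H2⟩ := famTwo_at_member Rr Hp b hM₂ hδG hδX hδO hKG hKX hBO
  obtain ⟨ρ₃, κ₃, Θ₃, M₀₃, T₀₃, N₀₃, hρ₃, hκ₃, hΘ₃, a₁₃, ha₁₃, H3⟩ := famThree_at_member Rr Hp b hℓ hM₂ hrepr hδG hδX hδO hKG hKX hBO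
  obtain ⟨δ₄, Θ₄, M₀₄, T₀₄, N₀₄, hδ₄, hΘ₄, a₁₄, ha₁₄, H4⟩ := sum_conj_famFour_at_locCfg' b hℓ hb₀ hb₁ M₂ hM₂ hrepr
  obtain ⟨δE, ΘE, M₀E, T₀E, N₀E, hδE, hΘE, a₁E, ha₁E, HE⟩ := sum_conj_locDefect_at_locCfg' b hℓ hb₀ hb₁ M₂ hM₂ hrepr
  -- ═══ the common rate and constant ═══
  obtain ⟨δ₀, hδ₀def⟩ : ∃ x : ℝ, x = min ρ₂ (min ρ₃ (min δ₄ (min δE δO))) := ⟨_, rfl⟩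
  have hδ₀ : 0 < δ₀ := by rw [hδ₀def]; exact lt_min hρ₂ (lt_min hρ₃ (lt_min hδ₄ (lt_min hδE hδO)))
  have hδ₀2 : δ₀ ≤ ρ₂ := by rw [hδ₀def]; exact min_le_left _ _
  have hδ₀3 : δ₀ ≤ ρ₃ := by rw [hδ₀def]; exact (min_le_right _ _).trans (min_le_left _ _)
  have hδ₀4 : δ₀ ≤ δ₄ := by rw [hδ₀def]; exact ((min_le_right _ _).trans (min_le_right _ _)).trans (min_le_left _ _)
  have hδ₀E : δ₀ ≤ δE := by
    rw [hδ₀def]; exact (((min_le_right _ _).trans (min_le_right _ _)).trans (min_le_right _ _)).trans (min_le_left _ _)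
  have hδ₀O : δ₀ ≤ δO := by
    rw [hδ₀def]; exact (((min_le_right _ _).trans (min_le_right _ _)).trans (min_le_right _ _)).trans (min_le_right _ _)
  obtain ⟨K₀, hK₀def⟩ : ∃ x : ℝ, x = Θ₂ * κ₂⁻¹ + Θ₃ * κ₃⁻¹ + Θ₄ + ΘE * δE⁻¹ := ⟨_, rfl⟩
  have hK₀ : 0 ≤ K₀ := by rw [hK₀def]; positivity
  refine ⟨δ₀, K₀, BO, max (max (max (M₀G) (M₀X)) (max (M₀O) (M₀₂))) (max (max (M₀₃) (M₀₄)) (max (M₀E) ((2 * ((ℓ : ℝ) + 1) ^ 2)))), max (max (T₀G) (max (T₀X) (T₀O))) (max (T₀₃) (max (T₀₄) (T₀E))), max (max (N₀G) (max (N₀X) (N₀O))) (max (N₀₃) (max (N₀₄) (N₀E))), hδ₀, hK₀, hBO, min (min (a₁G) (min (a₁X) (a₁O))) (min (a₁₃) (min (a₁₄) (a₁E))),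
    lt_min (lt_min ha₁G (lt_min ha₁X ha₁O)) (lt_min ha₁₃ (lt_min ha₁₄ ha₁E)), ?_⟩
  intro i hM hN hT hcf ιB hι U hUu g hg A Q C ξ Λ hC0 hξ hΛ hξS hΛξ hQ hgA hAb hdA hs₁ hs₄ B cfg par U₁ hcfg
  subst hcfg
  -- ─── thresholds ───
  have hMG : M₀G ≤ ((ℓ : ℝ) + 1) * (toKT i).Mh := le_trans ((((le_max_left _ _)).trans (le_max_left _ _)).trans (le_max_left _ _)) hM
  have hMX : M₀X ≤ ((ℓ : ℝ) + 1) * (toKT i).Mh := le_trans ((((le_max_right _ _)).trans (le_max_left _ _)).trans (le_max_left _ _)) hM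
  have hMO : M₀O ≤ ((ℓ : ℝ) + 1) * (toKT i).Mh := le_trans ((((le_max_left _ _)).trans (le_max_right _ _)).trans (le_max_left _ _)) hM
  have hM2 : M₀₂ ≤ ((ℓ : ℝ) + 1) * (toKT i).Mh := le_trans ((((le_max_right _ _)).trans (le_max_right _ _)).trans (le_max_left _ _)) hM
  have hM3 : M₀₃ ≤ ((ℓ : ℝ) + 1) * (toKT i).Mh := le_trans ((((le_max_left _ _)).trans (le_max_left _ _)).trans (le_max_right _ _)) hM
  have hM4 : M₀₄ ≤ ((ℓ : ℝ) + 1) * (toKT i).Mh := le_trans ((((le_max_right _ _)).trans (le_max_left _ _)).trans (le_max_right _ _)) hM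
  have hME : M₀E ≤ ((ℓ : ℝ) + 1) * (toKT i).Mh := le_trans ((((le_max_left _ _)).trans (le_max_right _ _)).trans (le_max_right _ _)) hM
  have hML : (2 * ((ℓ : ℝ) + 1) ^ 2) ≤ ((ℓ : ℝ) + 1) * (toKT i).Mh := le_trans ((((le_max_right _ _)).trans (le_max_right _ _)).trans (le_max_right _ _)) hM
  have hTG : T₀G ≤ RM1 i := le_trans (((le_max_left _ _)).trans (le_max_left _ _)) hT
  have hTX : T₀X ≤ RM1 i := le_trans ((((le_max_left _ _)).trans (le_max_right _ _)).trans (le_max_left _ _)) hT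
  have hTO : T₀O ≤ RM1 i := le_trans ((((le_max_right _ _)).trans (le_max_right _ _)).trans (le_max_left _ _)) hT
  have hT3 : T₀₃ ≤ RM1 i := le_trans (((le_max_left _ _)).trans (le_max_right _ _)) hT
  have hT4 : T₀₄ ≤ RM1 i := le_trans ((((le_max_left _ _)).trans (le_max_right _ _)).trans (le_max_right _ _)) hT
  have hTE : T₀E ≤ RM1 i := le_trans ((((le_max_right _ _)).trans (le_max_right _ _)).trans (le_max_right _ _)) hT
  have hNG : N₀G + 1 ≤ (toKT i).R * ((ℓ + 1) * (toKT i).Mh) := le_trans (Nat.succ_le_succ (((le_max_left _ _)).trans (le_max_left _ _))) hN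
  have hNX : N₀X + 1 ≤ (toKT i).R * ((ℓ + 1) * (toKT i).Mh) := le_trans (Nat.succ_le_succ ((((le_max_left _ _)).trans (le_max_right _ _)).trans (le_max_left _ _))) hN
  have hNO : N₀O + 1 ≤ (toKT i).R * ((ℓ + 1) * (toKT i).Mh) := le_trans (Nat.succ_le_succ ((((le_max_right _ _)).trans (le_max_right _ _)).trans (le_max_left _ _))) hN
  have hN3 : N₀₃ + 1 ≤ (toKT i).R * ((ℓ + 1) * (toKT i).Mh) := le_trans (Nat.succ_le_succ (((le_max_left _ _)).trans (le_max_right _ _))) hN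
  have hN4 : N₀₄ + 1 ≤ (toKT i).R * ((ℓ + 1) * (toKT i).Mh) := le_trans (Nat.succ_le_succ ((((le_max_left _ _)).trans (le_max_right _ _)).trans (le_max_right _ _))) hN
  have hNE : N₀E + 1 ≤ (toKT i).R * ((ℓ + 1) * (toKT i).Mh) := le_trans (Nat.succ_le_succ ((((le_max_right _ _)).trans (le_max_right _ _)).trans (le_max_right _ _))) hN
  have haG : ∀ c, max (C c) (C c * (1 + D1 thetaProf)) * Λ c ^ 2 ≤ a₁G := fun c => (hs₁ c).trans ((min_le_left _ _).trans ((min_le_left _ _)))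
  have haX : ∀ c, max (C c) (C c * (1 + D1 thetaProf)) * Λ c ^ 2 ≤ a₁X := fun c => (hs₁ c).trans ((min_le_left _ _).trans ((min_le_right _ _).trans ((min_le_left _ _))))
  have haO : ∀ c, max (C c) (C c * (1 + D1 thetaProf)) * Λ c ^ 2 ≤ a₁O := fun c => (hs₁ c).trans ((min_le_left _ _).trans ((min_le_right _ _).trans ((min_le_right _ _))))
  have ha3 : ∀ c, max (C c) (C c * (1 + D1 thetaProf)) * Λ c ^ 2 ≤ a₁₃ := fun c => (hs₁ c).trans ((min_le_right _ _).trans ((min_le_left _ _)))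
  have ha4 : ∀ c, max (C c) (C c * (1 + D1 thetaProf)) * Λ c ^ 2 ≤ a₁₄ := fun c => (hs₁ c).trans ((min_le_right _ _).trans ((min_le_right _ _).trans ((min_le_left _ _))))
  have haE : ∀ c, max (C c) (C c * (1 + D1 thetaProf)) * Λ c ^ 2 ≤ a₁E := fun c => (hs₁ c).trans ((min_le_right _ _).trans ((min_le_right _ _).trans ((min_le_right _ _))))
  have hMhEq : ((toKT i).Mh : ℝ) = (i.Mh : ℝ) := rfl
  have hMh8 : (8 : ℝ) ≤ (i.Mh : ℝ) := by exact_mod_cast i.hM8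
  have hMh0 : (0 : ℝ) < (i.Mh : ℝ) := by linarith only [hMh8]
  have hM2L : 2 * (ℓ + 1) ≤ i.Mh := by
    have h1 : 2 * ((ℓ : ℝ) + 1) ^ 2 ≤ ((ℓ : ℝ) + 1) * (i.Mh : ℝ) := by rw [← hMhEq]; exact hML
    have h1' : ((ℓ : ℝ) + 1) * (2 * ((ℓ : ℝ) + 1)) ≤ ((ℓ : ℝ) + 1) * (i.Mh : ℝ) := by
      calc ((ℓ : ℝ) + 1) * (2 * ((ℓ : ℝ) + 1)) = 2 * ((ℓ : ℝ) + 1) ^ 2 := by ring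
        _ ≤ ((ℓ : ℝ) + 1) * (i.Mh : ℝ) := h1
    have h2 : 2 * ((ℓ : ℝ) + 1) ≤ (i.Mh : ℝ) := le_of_mul_le_mul_left h1' hL0
    exact_mod_cast h2
  -- ─── the hermitian representative (H) ───
  obtain ⟨hAh, hgAh, hAbh, hdAh, hAuh, hVh⟩ := hermitianPart_cubeData hℓ i (cfg U₁) hUu g hg A Q C ξ Λ hC0 hξ hΛ hΛξ hgA hAb hdA hs₄
  -- ─── the member-level letters at the unitary fibre ───
  have hEG := (HG i hMG hNG hTG hcf ιB hι (cfg U₁) hUu g hg (fun c κ x => (2 : ℂ)⁻¹ • (A c κ x + star (A c κ x))) Q C ξ Λ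
    hC0 hξ hΛ hξS hΛξ hQ hgAh hAbh hdAh haG hs₄ cfg U₁ rfl).1
  have hCinv := HX i hMX hNX hTX hcf ιB hι (cfg U₁) hUu g hg (fun c κ x => (2 : ℂ)⁻¹ • (A c κ x + star (A c κ x))) Q C ξ Λ
    hC0 hξ hΛ hξS hΛξ hQ hgAh hAbh hdAh haX hs₄ cfg U₁ rfl
  have hXu : IsUnit (XY i (parSymY i) (GpY i (parSymY i)) (cfg U₁)) :=
    B9Thm311PosAtRecordV4.isUnit_XY_parSymY i (le_refl (unitaryUnits (Matrix (Fin N) (Fin N) ℂ))) hUu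
  have hUΔ : IsUnit (deltaPrimeAY i (parSymY i) (cfg U₁)) :=
    B9Thm311DeltaPrimePos.isUnit_deltaPrimeAY_parSymY i (le_refl (unitaryUnits (Matrix (Fin N) (Fin N) ℂ))) hUu
  have hpar : ∀ z w : SiteY i, ‖(parSymY i (cfg U₁) z w : (Matrix (Fin N) (Fin N) ℂ))‖ ≤ 1 ∧ ‖(((parSymY i (cfg U₁) z w)⁻¹ : (Matrix (Fin N) (Fin N) ℂ)ˣ) : (Matrix (Fin N) (Fin N) ℂ))‖ ≤ 1 :=
    fun z w => mem_U1.1 (unitaryUnits_le_U1 (parSymY_mem i hUu z w))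
  have hUbi : ∀ μ x, ‖(cfg U₁ μ x : (Matrix (Fin N) (Fin N) ℂ))‖ ≤ 1 ∧ ‖(((cfg U₁ μ x)⁻¹ : (Matrix (Fin N) (Fin N) ℂ)ˣ) : (Matrix (Fin N) (Fin N) ℂ))‖ ≤ 1 :=
    fun μ x => mem_U1.1 (unitaryUnits_le_U1 (hUu μ x))
  have hTbi : ∀ (y : IBondY i) (f : FBondY i), ‖(qT i (parBY i) (cfg U₁) y f : (Matrix (Fin N) (Fin N) ℂ))‖ ≤ 1 ∧
      ‖(((qT i (parBY i) (cfg U₁) y f)⁻¹ : (Matrix (Fin N) (Fin N) ℂ)ˣ) : (Matrix (Fin N) (Fin N) ℂ))‖ ≤ 1 :=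
    fun y f => mem_U1.1 (unitaryUnits_le_U1 (parBY_mem i hUu _ _))
  have hetaS : etaS i = (kGeo i).eta := B9Cor36GpCoverBindersUnitary.etaS_eq_kGeo_eta_of_cf i hcf
  have hη : etaS i = |i.cf|⁻¹ := by have h' := hetaS; exact h'
  -- the gauges and the localised configurations are unitary-valued (H)
  have hgu : ∀ c x, g c x ∈ unitaryUnits (Matrix (Fin N) (Fin N) ℂ) := fun c x => mem_unitaryUnits_of_bicontractive (g c x) (hg c x).1 (hg c x).2
  have hV'u : ∀ (c : ↥(cubes (toKT i).D.toDomains)) (μ : Fin (d + 1)) (x : Site (PV d ℓ i.m i.K hd hL) 0),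
      gaugeY i (g c)⁻¹ (locCfgY i c (kGeo i).eta (fun κ x => (2 : ℂ)⁻¹ • (A c κ x + star (A c κ x)))) μ x ∈ unitaryUnits (Matrix (Fin N) (Fin N) ℂ) := by
    intro c μ x
    rw [gaugeY_apply, Pi.inv_apply, Pi.inv_apply, inv_inv]
    exact Subgroup.mul_mem _ (Subgroup.mul_mem _ (Subgroup.inv_mem _ (hgu c x)) (hVh c μ x)) (hgu c _)
  have hparV : ∀ (c : ↥(cubes i.D.toDomains)) (z w : SiteY i),
      ‖(parSymY i (gaugeY i (g c)⁻¹ (locCfgY i c (kGeo i).eta (fun κ x => (2 : ℂ)⁻¹ • (A c κ x + star (A c κ x))))) z w : (Matrix (Fin N) (Fin N) ℂ))‖ ≤ 1 ∧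
        ‖(((parSymY i (gaugeY i (g c)⁻¹ (locCfgY i c (kGeo i).eta (fun κ x => (2 : ℂ)⁻¹ • (A c κ x + star (A c κ x))))) z w)⁻¹ : (Matrix (Fin N) (Fin N) ℂ)ˣ) : (Matrix (Fin N) (Fin N) ℂ))‖ ≤ 1 :=
    fun c z w => mem_U1.1 (unitaryUnits_le_U1 (parSymY_mem i (hV'u c) z w))
  -- ─── the cube letters' blocks and units (p38 `eBlock_locLetterBY''`) ───
  have HOc := fun c : ↥(cubes (toKT i).D.toDomains) => HO i c hMO hNO hTO (g c) (cfg U₁) (fun κ x => (2 : ℂ)⁻¹ • (A c κ x + star (A c κ x))) (Q c) (C c) (ξ c) (Λ c)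
    (hC0 c) (hξ c) (hΛ c) (hξS c) (hΛξ c) (hQ c) (hgAh c) (hAbh c) (hdAh c) (hAuh c) (haO c) (hg c) ιB hι (Rr i) (Hp i) cfg par U₁ rfl
  have hEO : ∀ c : ↥(cubes i.D.toDomains), EBlock (kernelFamilyBInv i B cfg (fun _ => locLetterBY i c (parSymY i) (parBY i) (g c) (chiY i c) (locCfgY i c (kGeo i).eta (fun κ x => (2 : ℂ)⁻¹ • (A c κ x + star (A c κ x))))) par) BO δO U₁ := fun c => (HOc c).2
  -- ─── the laws of the located letters (p33 `localInverse_defect_laws_chiY_parBY`) ───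
  have hQ3 : ∀ (c : ↥(cubes (toKT i).D.toDomains)) (x : Site (PV d ℓ i.m i.K hd hL) 0), NearC i c (3 * SC i c + 2) (boxEquiv i.hN x).1 → x ∈ Q c := by
    intro c x hx
    exact hQ c x (NearC.mono i c (radius_le (SC i c) (one_le_SC i c)) hx)
  have hlaws := fun c : ↥(cubes i.D.toDomains) => localInverse_defect_laws_chiY_parBY i c (parSymY i) hM2L (g c) (cfg U₁) (kGeo i).eta (fun κ x => (2 : ℂ)⁻¹ • (A c κ x + star (A c κ x)))
    (hQ3 c) (hgAh c) (HOc c).1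
  -- ─── the four families ───
  have h2 := H2 i hM2 hrepr cfg (GpY i (parSymY i)) (parSymY i) par hEG (fun c => fun _ => locLetterBY i c (parSymY i) (parBY i) (g c) (chiY i c) (locCfgY i c (kGeo i).eta (fun κ x => (2 : ℂ)⁻¹ • (A c κ x + star (A c κ x))))) hEO ιB hι hpar hη hCinv
  have h3 := H3 i hM3 hN3 hT3 hcf (cfg U₁) g hg (fun c κ x => (2 : ℂ)⁻¹ • (A c κ x + star (A c κ x))) Q C ξ Λ hC0 hξ hΛ hξS hΛξ hQ hgAh hAbh hdAh
    ha3 hs₄ cfg par U₁ rfl hEG (fun c => fun _ => locLetterBY i c (parSymY i) (parBY i) (g c) (chiY i c) (locCfgY i c (kGeo i).eta (fun κ x => (2 : ℂ)⁻¹ • (A c κ x + star (A c κ x))))) hEO ιB hι hpar hCinv hUΔ hXu hparV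
  have h4 := (H4 i hM4 hN4 hT4 g (fun c κ x => (2 : ℂ)⁻¹ • (A c κ x + star (A c κ x))) Q C ξ Λ hC0 hξ hΛ hξS hΛξ hQ hAbh hdAh hAuh ha4 hg
    (fun c => zetaY i c) (fun c z => abs_zetaY_le_one i c z) ιB hι (Rr i) (Hp i)).1
  have hD := (HE i hME hNE hTE g (fun c κ x => (2 : ℂ)⁻¹ • (A c κ x + star (A c κ x))) Q C ξ Λ hC0 hξ hΛ hξS hΛξ hQ hAbh hdAh hAuh haE hg
    ιB hι (Rr i) (Hp i)).1
  have hsum := hasMajorant_add _ (hasMajorant_add _ (hasMajorant_add _ h2 h3) h4) hD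
  refine ⟨fun c => (hlaws c).1, fun c => (hlaws c).2.1, fun c => (hlaws c).2.2, fun c => eBlock_rate_mono i _ le_rfl hδ₀O hBO (hEO c),
    hUbi, hTbi, hUΔ, hasMajorant_mono _ hsum fun a a' => ?_⟩
  -- ─── the kernel ───
  show Θ₂ * Real.exp (-(κ₂ * ((toKT i).Mh : ℝ))) * Real.exp (-(ρ₂ * (geo9K i).dist a a')) +
      Θ₃ * Real.exp (-(κ₃ * ((toKT i).Mh : ℝ))) * Real.exp (-(ρ₃ * (geo9K i).dist a a')) +
      Θ₄ * (((ℓ : ℝ) + 1) * ((toKT i).Mh : ℝ))⁻¹ * Real.exp (-(δ₄ * (geo9K i).dist a a')) +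
      ΘE * Real.exp (-(δE * (toKT i).Mh)) * Real.exp (-(δE * (geo9K i).dist a a')) ≤
    K₀ * (((toKT i).Mh : ℝ))⁻¹ * Real.exp (-(δ₀ * (geo9K i).dist a a'))
  have hd0 : 0 ≤ (geo9K i).dist a a' := B9GeoLemma21KLevelV1.geo9K_dist_nonneg' i a a'
  have hex : ∀ ⦃ρ : ℝ⦄, δ₀ ≤ ρ → Real.exp (-(ρ * (geo9K i).dist a a')) ≤ Real.exp (-(δ₀ * (geo9K i).dist a a')) :=
    fun ρ hρ => Real.exp_le_exp.mpr (by have h' := mul_le_mul_of_nonneg_right hρ hd0; linarith only [h'])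
  have hE0 : 0 ≤ Real.exp (-(δ₀ * (geo9K i).dist a a')) := Real.exp_nonneg _
  have hk2 : Θ₂ * Real.exp (-(κ₂ * ((toKT i).Mh : ℝ))) * Real.exp (-(ρ₂ * (geo9K i).dist a a')) ≤
      Θ₂ * κ₂⁻¹ * ((((toKT i).Mh : ℝ))⁻¹ * Real.exp (-(δ₀ * (geo9K i).dist a a'))) := by
    calc Θ₂ * Real.exp (-(κ₂ * ((toKT i).Mh : ℝ))) * Real.exp (-(ρ₂ * (geo9K i).dist a a'))
        ≤ Θ₂ * (κ₂⁻¹ * (((toKT i).Mh : ℝ))⁻¹) * Real.exp (-(δ₀ * (geo9K i).dist a a')) :=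
          mul_le_mul (mul_le_mul_of_nonneg_left (exp_neg_mul_le_inv hκ₂ (by rw [hMhEq]; exact hMh0)) hΘ₂) (hex hδ₀2) (Real.exp_nonneg _)
            (by positivity)
      _ = Θ₂ * κ₂⁻¹ * ((((toKT i).Mh : ℝ))⁻¹ * Real.exp (-(δ₀ * (geo9K i).dist a a'))) := by ring
  have hk3 : Θ₃ * Real.exp (-(κ₃ * ((toKT i).Mh : ℝ))) * Real.exp (-(ρ₃ * (geo9K i).dist a a')) ≤
      Θ₃ * κ₃⁻¹ * ((((toKT i).Mh : ℝ))⁻¹ * Real.exp (-(δ₀ * (geo9K i).dist a a'))) := by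
    calc Θ₃ * Real.exp (-(κ₃ * ((toKT i).Mh : ℝ))) * Real.exp (-(ρ₃ * (geo9K i).dist a a'))
        ≤ Θ₃ * (κ₃⁻¹ * (((toKT i).Mh : ℝ))⁻¹) * Real.exp (-(δ₀ * (geo9K i).dist a a')) :=
          mul_le_mul (mul_le_mul_of_nonneg_left (exp_neg_mul_le_inv hκ₃ (by rw [hMhEq]; exact hMh0)) hΘ₃) (hex hδ₀3) (Real.exp_nonneg _)
            (by positivity)
      _ = Θ₃ * κ₃⁻¹ * ((((toKT i).Mh : ℝ))⁻¹ * Real.exp (-(δ₀ * (geo9K i).dist a a'))) := by ring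
  have hk4 : Θ₄ * (((ℓ : ℝ) + 1) * ((toKT i).Mh : ℝ))⁻¹ * Real.exp (-(δ₄ * (geo9K i).dist a a')) ≤
      Θ₄ * ((((toKT i).Mh : ℝ))⁻¹ * Real.exp (-(δ₀ * (geo9K i).dist a a'))) := by
    have hinv : (((ℓ : ℝ) + 1) * ((toKT i).Mh : ℝ))⁻¹ ≤ (((toKT i).Mh : ℝ))⁻¹ := by
      rw [hMhEq]
      exact inv_anti₀ hMh0 (le_mul_of_one_le_left hMh0.le hL1)
    calc Θ₄ * (((ℓ : ℝ) + 1) * ((toKT i).Mh : ℝ))⁻¹ * Real.exp (-(δ₄ * (geo9K i).dist a a'))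
        ≤ Θ₄ * (((toKT i).Mh : ℝ))⁻¹ * Real.exp (-(δ₀ * (geo9K i).dist a a')) :=
          mul_le_mul (mul_le_mul_of_nonneg_left hinv hΘ₄) (hex hδ₀4) (Real.exp_nonneg _) (by rw [hMhEq]; positivity)
      _ = Θ₄ * ((((toKT i).Mh : ℝ))⁻¹ * Real.exp (-(δ₀ * (geo9K i).dist a a'))) := by ring
  have hkE : ΘE * Real.exp (-(δE * (toKT i).Mh)) * Real.exp (-(δE * (geo9K i).dist a a')) ≤
      ΘE * δE⁻¹ * ((((toKT i).Mh : ℝ))⁻¹ * Real.exp (-(δ₀ * (geo9K i).dist a a'))) := by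
    calc ΘE * Real.exp (-(δE * (toKT i).Mh)) * Real.exp (-(δE * (geo9K i).dist a a'))
        ≤ ΘE * (δE⁻¹ * (((toKT i).Mh : ℝ))⁻¹) * Real.exp (-(δ₀ * (geo9K i).dist a a')) :=
          mul_le_mul (mul_le_mul_of_nonneg_left (exp_neg_mul_le_inv hδE (by rw [hMhEq]; exact hMh0)) hΘE) (hex hδ₀E) (Real.exp_nonneg _)
            (by positivity)
      _ = ΘE * δE⁻¹ * ((((toKT i).Mh : ℝ))⁻¹ * Real.exp (-(δ₀ * (geo9K i).dist a a'))) := by ring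
  calc Θ₂ * Real.exp (-(κ₂ * ((toKT i).Mh : ℝ))) * Real.exp (-(ρ₂ * (geo9K i).dist a a')) +
        Θ₃ * Real.exp (-(κ₃ * ((toKT i).Mh : ℝ))) * Real.exp (-(ρ₃ * (geo9K i).dist a a')) +
        Θ₄ * (((ℓ : ℝ) + 1) * ((toKT i).Mh : ℝ))⁻¹ * Real.exp (-(δ₄ * (geo9K i).dist a a')) +
        ΘE * Real.exp (-(δE * (toKT i).Mh)) * Real.exp (-(δE * (geo9K i).dist a a'))
      ≤ Θ₂ * κ₂⁻¹ * ((((toKT i).Mh : ℝ))⁻¹ * Real.exp (-(δ₀ * (geo9K i).dist a a'))) +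
        Θ₃ * κ₃⁻¹ * ((((toKT i).Mh : ℝ))⁻¹ * Real.exp (-(δ₀ * (geo9K i).dist a a'))) +
        Θ₄ * ((((toKT i).Mh : ℝ))⁻¹ * Real.exp (-(δ₀ * (geo9K i).dist a a'))) +
        ΘE * δE⁻¹ * ((((toKT i).Mh : ℝ))⁻¹ * Real.exp (-(δ₀ * (geo9K i).dist a a'))) := add_le_add (add_le_add (add_le_add hk2 hk3) hk4) hkE
    _ = K₀ * (((toKT i).Mh : ℝ))⁻¹ * Real.exp (-(δ₀ * (geo9K i).dist a a')) := by rw [hK₀def]; ring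

end Literature.MathematicalPhysics.QuantumFieldTheory.Balaban1983to89.B9Eq3105RestAtMember
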